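import Summits.ResolutionOfSingularities.ResolutionOfSingularities.Theses.MaxContactCut
import Summits.ResolutionOfSingularities.ResolutionOfSingularities.Theorems.MaxOrderAtomClasses
import Summits.ResolutionOfSingularities.ResolutionOfSingularities.Theorems.MaxContactCutExhaustion
import Literature.AlgebraicGeometry.Resolution.EmbeddedResolutionExcellentSurfacesSequence
import HarnessLib

/-!
# MaxContactCutCompanionReduction — Part B kernels of the decomp-res node «MaxOrderAtoms» (lens-3 g7) BY NAME

Source HOME/decomp-res-lens-3/g7/MaxOrderAtoms.lean (sha256 91036a4fcfe2fdc9; critic `lean check` rc 0, 0 sorry),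
CRITIC-LEDGER row 46: CLEARED AS MAP + PORT-SHARPENING NODE.  The one remaining seam of the cell's tame pocket —
X1 = `MaxContactCut.MarkedThreefoldResolution` (stmt-28616; DESK T-X1-scope «general marking c: (β) the
ord-stratified assembly UNDECIDED-in-print») — is split by the certified translation into
* `MaxContactCut.CompanionReduction` (aside; COSTUME(cite): Włodarczyk's Step 2 «(J,E,c) ↦ companion max-order marked
  ideal», char-free ⇒ KNOWN-MOD-PORT [Wlodarczyk2005 §4 Step 2; BierstoneGrigorievMilmanWlodarczyk2011 §5]) and
* `MaxContactCut.MaxOrderThreefoldResolution` (aside; ∀ c ≥ 1, MaxOrd₃^E(c) = `MaxOrderThreefoldResolutionAt c` of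
  `Theorems.MaxOrderAtomClasses`: Cutkosky2009 Thm. 5.1 over k̄ with E = ∅ ⇒ KNOWN-MOD-PORT, ports (i) snc-boundary
  bookkeeping and (ii) k̄ ↦ any field; an ATTACK piece, NOT summit-implied — embedded statements are stronger than S).
Re-booking (critic row 46): T-X1-scope's «(β) UNDECIDED» is DISCHARGED to COSTUME(cite); the desk entry now books only
the ports (i)/(ii).  Kernels (all PROVED, 0 sorry): `maxOrderEmpty_of_x1`, `maxOrderEmpty_of_item` (X1 ⟹ every
boundary-free max-order slice, via lens-5's landed `MaxContactCutExhaustion.markedThreefoldResolutionAt_of_item`),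
`markedThreefold_of_companion` (X1 ⟸ the two asides), `companionReduction_of_item` (X1 ⟹ CompanionReduction: the
costume is necessary), `x1_iff_maxOrder` (EXACT given the boundary port, recorded as a hypothesis),
`pocket_of_companion` (both banked dim-4 rungs 28008 ∧ 28009 through `MaxContactCutExhaustion.pocket_of_items`).
Why this is novel (cell-relative): the tame pocket's last undecided seam is moved from «UNDECIDED in print» to a
printed, characteristic-free reduction plus a Cutkosky-5.1-format statement with two named ports.
-/

namespace Summit.ResolutionOfSingularities.ResolutionOfSingularities.Theorems.MaxContactCutCompanionReduction

open CategoryTheory AlgebraicGeometry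
open Literature.AlgebraicGeometry.Resolution
open Summit.ResolutionOfSingularities.ResolutionOfSingularities.Theses
open Summit.ResolutionOfSingularities.ResolutionOfSingularities.Theorems
open MaxOrderAtomClasses

/-- Restriction: X1 sliced at `c` (lens-5's `MarkedThreefoldResolutionAt c`) gives the boundary-free max-order slice
(an order bound `≤ c` forces `ord ≠ ⊤`). [folklore] -/
theorem maxOrderEmpty_of_x1 (c : ℕ) (h : MaxContactCutExhaustion.MarkedThreefoldResolutionAt c) :
    MaxOrderThreefoldResolutionEmptyAt c :=
  fun p hp k _ _ S g h₁ h₂ h₃ hS hdim J hord =>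
    h p hp k S g h₁ h₂ h₃ hS hdim J fun y => ne_top_of_le_ne_top (ENat.coe_ne_top c) (hord y)

/-- Restriction: the route aside X1 (stmt-28616 BY NAME) gives every boundary-free max-order slice. [folklore] -/
theorem maxOrderEmpty_of_item (h : MaxContactCut.MarkedThreefoldResolution) (c : ℕ) (hc : 1 ≤ c) :
    MaxOrderThreefoldResolutionEmptyAt c :=
  maxOrderEmpty_of_x1 c (MaxContactCutExhaustion.markedThreefoldResolutionAt_of_item h c hc)

/-- **X1 (stmt-28616 BY NAME) ⟸ `CompanionReduction` ∧ `MaxOrderThreefoldResolution`** (modus ponens over the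
certified translation). [cite: Wlodarczyk2005, §4 Step 2] -/
theorem markedThreefold_of_companion (hC : MaxContactCut.CompanionReduction)
    (hM : MaxContactCut.MaxOrderThreefoldResolution) : MaxContactCut.MarkedThreefoldResolution :=
  hC hM

/-- Necessity of the costume: X1 itself implies `CompanionReduction`. [folklore] -/
theorem companionReduction_of_item (h : MaxContactCut.MarkedThreefoldResolution) : MaxContactCut.CompanionReduction :=
  fun _ => h

/-- Unfolding: the aside `MaxOrderThreefoldResolution` is the family of slices `MaxOrderThreefoldResolutionAt c`,
`c ≥ 1`. [folklore] -/
theorem maxOrderThreefoldResolution_iff :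
    MaxContactCut.MaxOrderThreefoldResolution ↔ ∀ c : ℕ, 1 ≤ c → MaxOrderThreefoldResolutionAt c :=
  Iff.rfl

/-- The aside gives every boundary-free slice (`E = []`, landed `MaxOrderAtomClasses.maxOrderEmpty_of_bdry`).
[folklore] -/
theorem maxOrderEmpty_of_maxOrder (h : MaxContactCut.MaxOrderThreefoldResolution) (c : ℕ) (hc : 1 ≤ c) :
    MaxOrderThreefoldResolutionEmptyAt c :=
  maxOrderEmpty_of_bdry c (h c hc)

/-- **EXACTNESS of the split beneath X1 given the costume**: X1 ⟺ `MaxOrderThreefoldResolution` whenever the boundary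
port `(∀ c ≥ 1, MaxOrd₃^∅(c)) → (∀ c ≥ 1, MaxOrd₃^E(c))` holds (port (i), recorded as a hypothesis; not claimed).
[folklore] -/
theorem x1_iff_maxOrder (hC : MaxContactCut.CompanionReduction)
    (hPort : (∀ c : ℕ, 1 ≤ c → MaxOrderThreefoldResolutionEmptyAt c) → MaxContactCut.MaxOrderThreefoldResolution) :
    MaxContactCut.MarkedThreefoldResolution ↔ MaxContactCut.MaxOrderThreefoldResolution :=
  ⟨fun h => hPort (maxOrderEmpty_of_item h), fun h => hC h⟩

/-- **Both banked dim-4 rungs of MaxContactCut (28008 ∧ 28009) from the split X1**, through lens-5's landed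
`MaxContactCutExhaustion.pocket_of_items` BY NAME (X2 = `ExhaustionStep` 28617, X3 = `ExhaustionBase` 28618, the
printed CJS fact). [cite: CossartJannsenSaito2020, Thm. 1.4] -/
theorem pocket_of_companion (hC : MaxContactCut.CompanionReduction) (hM : MaxContactCut.MaxOrderThreefoldResolution)
    (h2 : MaxContactCut.ExhaustionStep) (h3 : MaxContactCut.ExhaustionBase)
    (hCJS : CossartJannsenSaito2020EmbeddedSequenceB.{0}) :
    MaxContactCut.LocalOrderOneResolveDimFour ∧ MaxContactCut.StepContactDimFour :=
  MaxContactCutExhaustion.pocket_of_items (hC hM) h2 h3 hCJS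

end Summit.ResolutionOfSingularities.ResolutionOfSingularities.Theorems.MaxContactCutCompanionReduction
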